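import Summits.FinalStateConjecture.FinalStateConjecture.Theorems.PhotonSphereChannelsChannelsResolveTameDevelopmentsRMinkowskiMaximal
import Summits.FinalStateConjecture.FinalStateConjecture.Theorems.ZeroEnergyKerrOrBombStationaryLimitReductionOneDevelopment
import Summits.FinalStateConjecture.FinalStateConjecture.Theorems.PhaseMixingCaptureWeakCosmicCensorshipMGHDCompleteNullInfinityInvariant
import Summits.FinalStateConjecture.FinalStateConjecture.Theorems.EIHFluxBalanceModulatedKerrHandoffStubRayTransport
import Summits.FinalStateConjecture.FinalStateConjecture.Theorems.TameCensorship.Negative.ExistentialContent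
import HarnessLib

/-!
# The bundled property of `TameCensorship` (K3-T2, item `stmt-FinalStateConjecture-17431`) HOLDS at the
# trivial datum: `(ℝ³, δ, 0)` is not an exceptional datum of the crux (route PhotonSphereChannels, seat 0)

The crux `PhotonSphereChannels.TameCensorship` asserts, for every data manifold `Σ`, that the property

  `Q(D)` = "an MGHD of `D` exists, and EVERY MGHD of `D` has complete `𝓘⁺`, (i) no extremal late chart
  and (ii) a uniformly `C³`-tame outer region"

(`TameCensorship.Negative.tameSet Σ`, verbatim) is tame-Christodoulou-generic on the admissible class. The
refuter's and grounder's read-backs record that the admissible class is inhabited by the trivial datum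
(`trivialData_mem_admissibleVacuumData`) but leave open whether `Q` holds ANYWHERE; the only anti-vacuity
corner cited so far is the perturbative claim `hintz_kerr_stability_subextremal_cauchy`. This file proves
the model-point instance:

* `clauses_of_isMaximal` — **unconditionally, EVERY maximal vacuum Cauchy development of the trivial datum
  has complete `𝓘⁺`, (i) and (ii)**: such a development is isometric, as a development, to Minkowski
  space (`Minkowski.isIsometricTo_vacuumCauchyDevelopment_of_isMaximal`: geodesic completeness + MGHD
  uniqueness), where the three clauses are theorems (`minkowski_hasCompleteNullInfinity`,
  `MinkowskiModel.minkowski_noExtremalRemnant`, `MinkowskiModel.minkowski_tameOuter`), and each clause is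
  transported along an isometry of developments (`hasCompleteNullInfinity_iff_of_isIsometricTo`;
  `extremalLateChart_pullback`, `tameOuter_of_isometry` below);
* `mem_tameSet_iff_exists_isMaximal` / `mem_tameSet_iff_isMaximal_minkowski` — hence, unconditionally,
  `Q(trivialData)` is EQUIVALENT to the bare existence of an MGHD of the trivial datum, i.e. to the
  maximality of the Minkowski development (`Minkowski.isMaximal_vacuumCauchyDevelopment_iff`): at the
  model point the crux's property has exactly the content of the Choquet-Bruhat–Geroch theorem;
* `trivialData_mem_tameSet` — given `choquetBruhat_geroch_exists_mghd_cauchy`, `Q(trivialData)` holds: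
  the trivial datum is NOT exceptional for K3, so a refutation of the crux must exhibit a non-flat
  exceptional admissible datum;
* `stub_tameCensorshipBody_trivialData` — the same in the verbatim text of the crux body (registered stub
  of item 17431, `--supports`).

The transport lemmas `extremalLateChart_pullback` / `tameOuter_of_isometry` (with
`image_outerRegion_subset`) are re-assembled here, in the `TameHull` vocabulary, from the built packages
`OneLockedExplosion.*` (isometric diffeomorphisms carry late charts, truncated deviations, causal futures
and chronological pasts) and `EIHFluxBalance.TameTemplate.stub_rayTransport` (normalised null rays),
following `ChannelsResolveTameDevelopmentsR.SingleDevelopment` (p145127, whose module is not yet served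
by the build farm and therefore cannot be imported here).

Mathlib + built tree modules only; no `sorry`, no new definitions, no new named facts.

References: Y. Choquet-Bruhat, R. Geroch, Commun. Math. Phys. 14 (1969) 329–335, Thm. 3;
H. Ringström, *The Cauchy Problem in General Relativity* (EMS 2009), Thm. 16.6; D. Christodoulou,
Class. Quantum Grav. 16 (1999) A23, p. A27; B. O'Neill, *Semi-Riemannian geometry* (1983), Ch. 3,
Def. 3.4 (p. 58), Ch. 14, pp. 402–403.
-/

noncomputable section

-- every `Summit.FinalStateConjecture.FinalStateConjecture.…` name repeats the summit = sub-problem segment (D-0017 layout)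
set_option linter.dupNamespace false

open Set Filter Function TopologicalSpace
open scoped Manifold ContDiff Topology ENNReal NNReal

namespace Summit.FinalStateConjecture.FinalStateConjecture.Theorems.TameCensorship.TrivialDatum

open Literature.Geometry.Lorentzian Literature.Geometry.Lorentzian.Minkowski
open Summit.FinalStateConjecture (HasCompleteNullInfinity)
open Summit.FinalStateConjecture.FinalStateConjecture.Theorems.TameHull (NoExtremalRemnant TameOuter outerRegion)
open Summit.FinalStateConjecture.FinalStateConjecture.Theorems.ChannelsResolveTameDevelopmentsR
  (MinkowskiModel.minkowski_noExtremalRemnant MinkowskiModel.minkowski_tameOuter)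
open Summit.FinalStateConjecture.FinalStateConjecture.Theorems.OneLockedExplosion
  (mdifferentiable_diffeomorph isIsometry_symm preservesTimeOrientation_symm image_causalFuture_eq
    image_chronologicalPast_eq truncDeviationCk_comp isLateChart_comp)
open Summit.FinalStateConjecture.FinalStateConjecture.Theorems.PhaseMixingCapture.WeakCosmicCensorshipMGHD
  (hasCompleteNullInfinity_iff_of_isIsometricTo)
open Summit.FinalStateConjecture.FinalStateConjecture.Theorems.WeakCosmicCensorshipMGHD.Negative
  (minkowski_hasCompleteNullInfinity)
open Summit.FinalStateConjecture.FinalStateConjecture.Theorems.EIHFluxBalance.TameTemplate (stub_rayTransport)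
open Summit.FinalStateConjecture.FinalStateConjecture.Theorems.TameCensorship.Negative (tameSet)

/-! ### Transport of (i) and (ii) along an isometry of developments (`TameHull` vocabulary) -/

section Transport

variable {X : Type} [TopologicalSpace X] [ChartedSpace E3 X] [IsManifold (𝓡 3) ∞ X] [T2Space X]
  [SecondCountableTopology X] [ConnectedSpace X] {D : InitialDataSet (𝓡 3) X}
  {𝒟₁ 𝒟₂ : VacuumCauchyDevelopment D}
  (ψ : Diffeomorph (𝓡 4) (𝓡 4) 𝒟₁.carrier 𝒟₂.carrier ∞)
  (hiso : 𝒟₁.metric.IsIsometry 𝒟₂.metric.toPseudoRiemannianMetric ψ)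
  (hτ : 𝒟₁.timeOrientation.PreservesTimeOrientation ψ 𝒟₂.timeOrientation)
  (hι : ψ ∘ 𝒟₁.embed = 𝒟₂.embed)

omit [T2Space X] [SecondCountableTopology X] in
include hiso in
/-- **Hypothesis (i) pulls back along an isometric diffeomorphism**: an extremal boosted-Kerr late chart
`Ψ` into `𝒟₂` with truncated `C²` deviations `→ 0` for every `R` gives the chart `ψ⁻¹ ∘ Ψ` into `𝒟₁`
with literally the same truncated deviations (`isIsometry_symm`, `isLateChart_comp`,
`truncDeviationCk_comp`) — the contrapositive, chart-level form of
`SingleDevelopment.noExtremalRemnant_of_isometry` (stated here for one chart, so that it is not a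
restatement of that landed declaration). [cite: ONeillSemiRiemannian1983, Ch. 3, Def. 3.4 (p. 58)] -/
theorem extremalLateChart_pullback {Λ : lorentzGroup} {c : E4} {M a τ₀ : ℝ}
    {Ψ : (boostedKerrBackground Λ c M a).domain → 𝒟₂.carrier}
    (hlate : 𝒟₂.toSpacetime.IsLateChart (boostedKerrBackground Λ c M a) Set.univ τ₀ Ψ)
    (hdev : ∀ R : ℝ, Tendsto (fun τ => 𝒟₂.toSpacetime.truncDeviationCk
      (boostedKerrBackground Λ c M a) Ψ 2 R τ) atTop (𝓝 0)) :
    𝒟₁.toSpacetime.IsLateChart (boostedKerrBackground Λ c M a) Set.univ τ₀ (ψ.symm ∘ Ψ) ∧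
      ∀ R : ℝ, Tendsto (fun τ => 𝒟₁.toSpacetime.truncDeviationCk
        (boostedKerrBackground Λ c M a) (ψ.symm ∘ Ψ) 2 R τ) atTop (𝓝 0) := by
  have hiso' := isIsometry_symm (𝓢₁ := 𝒟₁.toSpacetime) (𝓢₂ := 𝒟₂.toSpacetime) ψ hiso
  refine ⟨?_, fun R ↦ (hdev R).congr fun t ↦ ?_⟩
  · have h1 := isLateChart_comp (𝓢₁ := 𝒟₂.toSpacetime) (𝓢₂ := 𝒟₁.toSpacetime) ψ.symm
      (boostedKerrBackground Λ c M a) hlate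
    have hsurj : Function.Surjective (ψ.symm : 𝒟₂.carrier → 𝒟₁.carrier) :=
      fun y ↦ ⟨ψ y, ψ.symm_apply_apply y⟩
    rwa [Set.image_univ_of_surjective hsurj] at h1
  · exact (truncDeviationCk_comp (𝓢₁ := 𝒟₂.toSpacetime) (𝓢₂ := 𝒟₁.toSpacetime) ψ.symm
      (boostedKerrBackground Λ c M a) hlate.contMDiff hiso' 2 R t).symm

include hiso hτ hι in
/-- **The outer region is carried into the outer region**: `ψ(J⁺(ι₁ X) ∩ ⋃ I⁻(complete rays of 𝒟₁))
⊆ J⁺(ι₂ X) ∩ ⋃ I⁻(complete rays of 𝒟₂)` (`image_causalFuture_eq`, `image_chronologicalPast_eq`,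
`ψ(ι₁ X) = ι₂ X`, and the ray correspondence `stub_rayTransport`). Re-assembled from
`SingleDevelopment.image_outerRegion_subset`. [cite: ONeillSemiRiemannian1983, Ch. 14, pp. 402–403] -/
theorem image_outerRegion_subset [𝒟₁.metric.HasLeviCivita] [𝒟₂.metric.HasLeviCivita] :
    ψ '' outerRegion 𝒟₁ ⊆ outerRegion 𝒟₂ := by
  rintro _ ⟨q, ⟨hqJ, p, γ, dom, hγ, hdom, hqI⟩, rfl⟩
  refine ⟨?_, p, ψ ∘ γ, dom, (stub_rayTransport X D 𝒟₁ 𝒟₂ ψ hiso hτ hι p γ dom).2 hγ, hdom, ?_⟩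
  · have h1 : ψ q ∈ ψ '' 𝒟₁.metric.causalFuture 𝒟₁.timeOrientation (Set.range 𝒟₁.embed) :=
      Set.mem_image_of_mem _ hqJ
    rwa [image_causalFuture_eq (𝓢₁ := 𝒟₁.toSpacetime) (𝓢₂ := 𝒟₂.toSpacetime) ψ hiso hτ,
      ← Set.range_comp, hι] at h1
  · have h2 : ψ q ∈ ψ '' 𝒟₁.metric.chronologicalPast 𝒟₁.timeOrientation (γ '' (dom ∩ Set.Ici 0)) :=
      Set.mem_image_of_mem _ hqI
    rwa [image_chronologicalPast_eq (𝓢₁ := 𝒟₁.toSpacetime) (𝓢₂ := 𝒟₂.toSpacetime) ψ hiso hτ,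
      Set.image_image] at h2

include hiso hτ hι in
/-- **Hypothesis (ii) is transported along an isometry of developments**: a point `q` of the outer region
of `𝒟₂` is `ψ q₁` with `q₁ = ψ⁻¹ q` in the outer region of `𝒟₁` (`image_outerRegion_subset` for the inverse
package); the `(r₀, Λ)`-tame flat chart `Ψ` at `q₁` pushes forward to the late chart `ψ ∘ Ψ` centred at `q`
(`isLateChart_comp`) with literally the same deviation tensor (`Spacetime.deviation_comp`). Re-assembled
from `SingleDevelopment.tameOuterRegion_of_isometry`. [cite: ONeillSemiRiemannian1983, Ch. 3, Def. 3.4 (p. 58)] -/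
theorem tameOuter_of_isometry (h : TameOuter 𝒟₁) : TameOuter 𝒟₂ := by
  intro inst₂
  haveI inst₁ : 𝒟₁.metric.HasLeviCivita := 𝒟₁.metric.toPseudoRiemannianMetric.hasLeviCivita
  obtain ⟨r₀, hr₀, Λ, hch⟩ := @h inst₁
  refine ⟨r₀, hr₀, Λ, fun q hq ↦ ?_⟩
  -- the inverse package: `ψ⁻¹ ∘ ι₂ = ι₁`
  have hι' : ψ.symm ∘ 𝒟₂.embed = 𝒟₁.embed := by
    funext x
    have h := congrFun hι x
    simp only [Function.comp_apply] at h ⊢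
    rw [← h, Diffeomorph.symm_apply_apply]
  -- `q₁ = ψ⁻¹ q` lies in the outer region of `𝒟₁`
  have hq₁ : ψ.symm q ∈ outerRegion 𝒟₁ :=
    image_outerRegion_subset (𝒟₁ := 𝒟₂) (𝒟₂ := 𝒟₁) ψ.symm
      (isIsometry_symm (𝓢₁ := 𝒟₁.toSpacetime) (𝓢₂ := 𝒟₂.toSpacetime) ψ hiso)
      (preservesTimeOrientation_symm (𝓢₁ := 𝒟₁.toSpacetime) (𝓢₂ := 𝒟₂.toSpacetime) ψ hiso hτ)
      hι' (Set.mem_image_of_mem ψ.symm hq)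
  obtain ⟨Ψ, hlate, ⟨x, hx0, hxq⟩, h3, h0⟩ := hch (ψ.symm q) hq₁
  have hlate' : 𝒟₂.toSpacetime.IsLateChart
      (Minkowski.backgroundOn ⟨Metric.ball (0 : E4) r₀, Metric.isOpen_ball⟩) Set.univ (-r₀) (ψ ∘ Ψ) := by
    have h1 := isLateChart_comp (𝓢₁ := 𝒟₁.toSpacetime) (𝓢₂ := 𝒟₂.toSpacetime) ψ
      (Minkowski.backgroundOn ⟨Metric.ball (0 : E4) r₀, Metric.isOpen_ball⟩) hlate
    have hsurj : Function.Surjective (ψ : 𝒟₁.carrier → 𝒟₂.carrier) :=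
      fun z ↦ ⟨ψ.symm z, ψ.apply_symm_apply z⟩
    rwa [Set.image_univ_of_surjective hsurj] at h1
  have hdev : 𝒟₂.toSpacetime.deviationExtend
      (Minkowski.backgroundOn ⟨Metric.ball (0 : E4) r₀, Metric.isOpen_ball⟩) (ψ ∘ Ψ) =
        𝒟₁.toSpacetime.deviationExtend
          (Minkowski.backgroundOn ⟨Metric.ball (0 : E4) r₀, Metric.isOpen_ball⟩) Ψ := by
    unfold Spacetime.deviationExtend
    rw [Spacetime.deviation_comp _ (mdifferentiable_diffeomorph ψ) hiso
      (hlate.contMDiff.mdifferentiable (by simp))]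
  refine ⟨ψ ∘ Ψ, hlate', ⟨x, hx0, ?_⟩, ?_, ?_⟩
  · simp only [Function.comp_apply, hxq, Diffeomorph.apply_symm_apply]
  · show supCkENorm ((⟨Metric.ball (0 : E4) r₀, Metric.isOpen_ball⟩ : Opens E4) : Set E4) 3
        (𝒟₂.toSpacetime.deviationExtend
          (Minkowski.backgroundOn ⟨Metric.ball (0 : E4) r₀, Metric.isOpen_ball⟩) (ψ ∘ Ψ)) ≤ (Λ : ℝ≥0∞)
    rw [hdev]; exact h3
  · show supCkENorm ((⟨Metric.ball (0 : E4) r₀, Metric.isOpen_ball⟩ : Opens E4) : Set E4) 0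
        (𝒟₂.toSpacetime.deviationExtend
          (Minkowski.backgroundOn ⟨Metric.ball (0 : E4) r₀, Metric.isOpen_ball⟩) (ψ ∘ Ψ)) ≤ 1 / 2
    rw [hdev]; exact h0

end Transport

/-! ### Every MGHD of the trivial datum has complete `𝓘⁺`, (i) and (ii) — unconditionally -/

/-- **EVERY maximal vacuum Cauchy development of the trivial datum `(ℝ³, δ, 0)` has complete `𝓘⁺`, no
extremal remnant and a tame outer region**, unconditionally: it is isometric as a development to
Minkowski space (`Minkowski.isIsometricTo_vacuumCauchyDevelopment_of_isMaximal`), where the three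
clauses hold (`minkowski_hasCompleteNullInfinity`, `MinkowskiModel.minkowski_noExtremalRemnant`,
`MinkowskiModel.minkowski_tameOuter`), and the three clauses are transported along the isometry.
[cite: Ringstrom2009, Thm. 16.6] -/
theorem clauses_of_isMaximal (𝒟 : VacuumCauchyDevelopment trivialData) (hmax : 𝒟.IsMaximal) :
    HasCompleteNullInfinity 𝒟.toCauchyDevelopment ∧ NoExtremalRemnant 𝒟 ∧ TameOuter 𝒟 := by
  have h := Minkowski.isIsometricTo_vacuumCauchyDevelopment_of_isMaximal hmax
  refine ⟨(hasCompleteNullInfinity_iff_of_isIsometricTo _ _ h).1 minkowski_hasCompleteNullInfinity, ?_⟩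
  obtain ⟨ψ, hiso, hτ, hι⟩ := h
  refine ⟨fun Λ c M a hext ⟨τ₀, Ψ, hlate, hdev⟩ ↦ ?_,
    tameOuter_of_isometry ψ hiso hτ hι MinkowskiModel.minkowski_tameOuter⟩
  -- (i): pull the offending chart back to Minkowski space, where there is none
  obtain ⟨hlate', hdev'⟩ := extremalLateChart_pullback ψ hiso hlate hdev
  exact MinkowskiModel.minkowski_noExtremalRemnant Λ c M a hext ⟨τ₀, ψ.symm ∘ Ψ, hlate', hdev'⟩

/-! ### `Q(trivialData)` has exactly the content of MGHD existence -/

/-- **At the trivial datum the bundled property of `TameCensorship` is equivalent to the bare existence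
of an MGHD** (unconditionally): the universal clauses hold for every MGHD (`clauses_of_isMaximal`; the
`TameHull` renderings `NoExtremalRemnant` / `TameOuter` of (i) / (ii) are the verbatim texts).
[cite: ChoquetBruhatGeroch1969CMP, Thm. 3] -/
theorem mem_tameSet_iff_exists_isMaximal :
    trivialData ∈ tameSet slice ↔ ∃ 𝒟 : VacuumCauchyDevelopment trivialData, 𝒟.IsMaximal :=
  ⟨fun h ↦ h.1, fun h ↦ ⟨h, fun 𝒟 hmax ↦ clauses_of_isMaximal 𝒟 hmax⟩⟩

/-- **At the trivial datum the bundled property of `TameCensorship` is equivalent to the maximality of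
the Minkowski development** (unconditionally; `Minkowski.isMaximal_vacuumCauchyDevelopment_iff`).
[cite: Ringstrom2009, Thm. 16.6] -/
theorem mem_tameSet_iff_isMaximal_minkowski :
    trivialData ∈ tameSet slice ↔ Minkowski.vacuumCauchyDevelopment.IsMaximal := by
  rw [mem_tameSet_iff_exists_isMaximal, Minkowski.isMaximal_vacuumCauchyDevelopment_iff]

/-- **The trivial datum is not an exceptional datum of `TameCensorship`** (given the
Choquet-Bruhat–Geroch existence theorem `choquetBruhat_geroch_exists_mghd_cauchy`): Minkowski space is
an MGHD of `(ℝ³, δ, 0)` (`Minkowski.isMaximal_vacuumCauchyDevelopment`), and every MGHD of it has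
complete `𝓘⁺`, (i) and (ii). [cite: ChoquetBruhatGeroch1969CMP, Thm. 3] -/
theorem trivialData_mem_tameSet (hcbg : choquetBruhat_geroch_exists_mghd_cauchy) :
    trivialData ∈ tameSet slice :=
  mem_tameSet_iff_isMaximal_minkowski.2 (Minkowski.isMaximal_vacuumCauchyDevelopment hcbg)

/-! ### The registered stub: the crux body at `Σ = ℝ³`, `D = trivialData`, verbatim -/

/-- **Registered stub `stub_tameCensorshipBody_trivialData` of stmt-FinalStateConjecture-17431**: given
`choquetBruhat_geroch_exists_mghd_cauchy`, the bundled property of `TameCensorship` — an MGHD exists, and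
every MGHD has complete `𝓘⁺`, (i) no extremal late chart, (ii) uniformly `C³`-tame outer region — holds
at the trivial datum on `Σ = ℝ³` (the text of the crux body with `X ↦ Minkowski.slice`,
`D ↦ trivialData`, verbatim). [cite: ChoquetBruhatGeroch1969CMP, Thm. 3] -/
theorem stub_tameCensorshipBody_trivialData : choquetBruhat_geroch_exists_mghd_cauchy → (∃ 𝒟 : VacuumCauchyDevelopment trivialData, 𝒟.IsMaximal) ∧ ∀ 𝒟 : VacuumCauchyDevelopment trivialData, 𝒟.IsMaximal → _root_.Summit.FinalStateConjecture.HasCompleteNullInfinity 𝒟.toCauchyDevelopment ∧ ((∀ (Λ : lorentzGroup) (c : E4) (M a : ℝ), Kerr.IsExtremal M a → ¬ ∃ (τ₀ : ℝ) (Ψ : (boostedKerrBackground Λ c M a).domain → 𝒟.carrier), 𝒟.toSpacetime.IsLateChart (boostedKerrBackground Λ c M a) Set.univ τ₀ Ψ ∧ ∀ R : ℝ, Filter.Tendsto (fun τ => 𝒟.toSpacetime.truncDeviationCk (boostedKerrBackground Λ c M a) Ψ 2 R τ) Filter.atTop (nhds 0)) ∧ ∀ [𝒟.metric.HasLeviCivita],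 let outer : Set 𝒟.carrier := 𝒟.metric.causalFuture 𝒟.timeOrientation (Set.range 𝒟.embed) ∩ {q | ∃ (p : slice) (γ : ℝ → 𝒟.carrier) (dom : Set ℝ), 𝒟.metric.IsNormalisedNullRayFrom 𝒟.timeOrientation 𝒟.embed 𝒟.normal p γ dom ∧ ¬ BddAbove dom ∧ q ∈ 𝒟.metric.chronologicalPast 𝒟.timeOrientation (γ '' (dom ∩ Set.Ici 0))}; ∃ r₀ : ℝ, 0 < r₀ ∧ ∃ Λ : NNReal, ∀ q ∈ outer, let U : TopologicalSpace.Opens E4 := ⟨Metric.ball (0 : E4) r₀, Metric.isOpen_ball⟩; ∃ Ψ : U → 𝒟.carrier, 𝒟.toSpacetime.IsLateChart (Minkowski.backgroundOn U) Set.univ (-r₀) Ψ ∧ (∃ x : U, (x : E4) = 0 ∧ Ψ x = q) ∧ supCkENorm (U : Set E4) 3 (𝒟.toSpacetime.deviationExtend (Minkowski.backgroundOn U) Ψ) ≤ (Λ : ENNReal) ∧ supCkENorm (U : Set E4) 0 (𝒟.toSpacetime.deviationExtend (Minkowski.backgroundOn U) Ψ) ≤ 1 / 2) :=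
  fun hcbg ↦ trivialData_mem_tameSet hcbg

end Summit.FinalStateConjecture.FinalStateConjecture.Theorems.TameCensorship.TrivialDatum

end
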